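import Literature.NumberTheory.LFunctions.SchoenfeldBrentSieveCount
import HarnessLib

/-!
# Brent's range of Schoenfeld 1976, Cor. 1: soundness of `li`, of the cell loop, and the block interface

Topic: `Literature/NumberTheory/LFunctions`. Last part of the soundness proof of the checker of
`SchoenfeldBrentSieve.lean` (discharge of `Literature.NumberTheory.LFunctions.Schoenfeld1976_brentRange`:
`|π(x) − li(x)| < 4613.5` for real `5·10⁷ ≤ x ≤ 49·10⁸`; L. Schoenfeld, Math. Comp. 30 (1976), proof
of Cor. 1, p. 340, from R. P. Brent, Math. Comp. 29 (1975), Table 1):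

* `liHiN_sound`, `liLoN_sound`: `liHiN n x ≥ 2⁸⁰ li x` (`1 < x`), `liLoN n x ≤ 2⁸⁰ li x` (`3 ≤ x`)
  for any number `n` of series terms — the proofs of `SchoenfeldSieve.liHi_sound` / `liLo_sound`
  (the case `n = 75`) verbatim with `NT` replaced by `n`;
* `cell_sound`: for real `x ∈ [a, b)`, `π(x) ∈ [π(a), π(b−1)]` and `li a ≤ li x ≤ li b`
  (`strictMonoOn_logIntegral_holds`), so the integer checks (U) `2(liHiN b − π(a)·2⁸⁰) < 9227·2⁸⁰`,
  (L) `2(π(b−1)·2⁸⁰ − liLoN a) < 9227·2⁸⁰` give `|π(x) − li(x)| < 4613.5` on the cell;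
* `tryCell_sound`, `segCells_sound`, `chunkSegs_sound`: a passing run entered with the correct count
  returns the correct count and proves the bound on every cell it visited;
* the block interface `BrentOK N c` (`c = π(N)` and the bound on `[49999999, N+1)`), `brentOK_init`,
  `brentOK_step` (consumed by `SchoenfeldBrentSieve/Chunk*.lean`, one `native_decide` each, and by the
  assembly), and the extraction `bound_of_brentOK` of the statement of the fact.

Everything here is proved from the standard axioms.

## References

* L. Schoenfeld, Math. Comp. 30 (1976), 337–360, proof of Cor. 1 (p. 340). [Schoenfeld1976]
* R. P. Brent, Math. Comp. 29 (1975), 43–56, Table 1. [Brent1975]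
-/

open Finset
open Literature.Analysis.SpecialFunctions.KernelLog
open Literature.Analysis.ValidatedNumerics.Numerics (cdiv fdiv_le_div div_le_cdiv)

namespace Literature.NumberTheory.LFunctions

namespace BrentSieve

open SchoenfeldSieve SchoenfeldNumerics PrimeTable

section Soundness

/-! ### `li` with `n` series terms -/

/-- **`seriesHiN` is an upper bound** (cf. `seriesHi_sound`). [folklore] -/
theorem seriesHiN_sound (n : ℕ) (U : ℝ) (u : ℤ) (hU : 0 ≤ U) (hu : U * SC ≤ u) :
    (∑ j ∈ range n, U ^ (j + 1) / ((j + 1 : ℝ) * ((j + 1).factorial : ℝ))) * SC ≤ (seriesHiN n u).1 ∧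
      U ^ (n + 1) / ((n + 1).factorial : ℝ) * SC ≤ (seriesHiN n u).2 := by
  have h := goHi_sound U u hU hu n 1 SC 0 le_rfl (by simp) (by simp)
  simp only [Nat.sub_self, zero_add] at h
  refine ⟨h.1, ?_⟩
  unfold seriesHiN
  dsimp only
  generalize hg : goHi u n 1 SC 0 = g at h ⊢
  have hSC := SC_pos
  have hn : (0 : ℤ) < (n : ℤ) + 1 := by positivity
  have h1 := div_le_cdiv (a := g.2 * u) (b := ((n : ℤ) + 1) * SC) (mul_pos hn (by unfold SC; norm_num))
  refine le_trans ?_ h1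
  have hn' : (0 : ℝ) < (n : ℝ) + 1 := by positivity
  push_cast
  rw [le_div_iff₀ (by positivity), Nat.factorial_succ, pow_succ]
  push_cast
  have hAnn : (0 : ℝ) ≤ g.2 := le_trans (by positivity) h.2
  calc U ^ n * U / ((↑n + 1) * (n.factorial : ℝ)) * SC * ((↑n + 1) * SC)
      = (U ^ n / (n.factorial : ℝ) * SC) * (U * SC) := by field_simp
    _ ≤ (g.2 : ℝ) * u := mul_le_mul h.2 hu (by positivity) hAnn

/-- **`seriesLoN` is a lower bound** (cf. `seriesLo_sound`). [folklore] -/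
theorem seriesLoN_sound (n : ℕ) (L' : ℝ) (l : ℤ) (hL : 0 ≤ L') (hl0 : 0 ≤ l) (hl : (l : ℝ) ≤ L' * SC) :
    ((seriesLoN n l : ℤ) : ℝ) ≤
      (∑ j ∈ range n, L' ^ (j + 1) / ((j + 1 : ℝ) * ((j + 1).factorial : ℝ))) * SC := by
  have h := goLo_sound L' l hL hl0 hl n 1 SC 0 le_rfl (by unfold SC; norm_num) (by simp) (by simp)
  simpa [seriesLoN] using h

/-- **`liHiN` is an upper bound**: `liHiN n x = some v`, `1 < x` ⟹ `2⁸⁰ li x ≤ v` (the proof of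
`liHi_sound` with `NT ↦ n`). [folklore] -/
theorem liHiN_sound {n x : ℕ} {v : ℤ} (h : liHiN n x = some v) (hx : 1 < x) :
    logIntegral x * 2 ^ 80 ≤ v := by
  unfold liHiN at h
  split at h
  · rename_i Llo Lhi hlog
    split at h
    · rename_i ll hll
      simp only [Option.some.injEq] at h
      subst h
      have hx' : (1 : ℝ) < x := by exact_mod_cast hx
      obtain ⟨hLlo, hLhi⟩ := logIv_sound hlog
      have hl0 : 0 < Real.log x := Real.log_pos hx'
      set U : ℝ := (Lhi : ℝ) / 2 ^ 80 with hU
      have hU0 : 0 ≤ U := hl0.le.trans hLhi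
      have hLhiR : Real.log x * 2 ^ 80 ≤ Lhi := by rwa [le_div_iff₀ (by positivity)] at hLhi
      have hLhi0 : 0 ≤ Lhi := by exact_mod_cast (le_trans (by positivity) hLhiR : (0 : ℝ) ≤ Lhi)
      have hli := (logIntegral_mem_Icc hx' n).2
      have hsum := sum_logIntegralSeriesTerm_le hx'.le hLhi n
      have hser := seriesHiN_sound n U Lhi hU0 (by rw [hU, SC_eq]; field_simp; rfl)
      rw [SC_eq] at hser
      have hll' := loglogHi_sound hll hLhi0 hl0 hLhiR
      have hγ := gamma_bounds.1
      have htail : (x : ℝ) * (Real.log x ^ (n + 1) / ((n + 1 : ℝ) * ((n + 1).factorial : ℝ))) * 2 ^ 80 ≤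
          (x : ℝ) * ((cdiv (seriesHiN n Lhi).2 ((n : ℤ) + 1) : ℤ) : ℝ) := by
        have h1 := div_le_cdiv (a := (seriesHiN n Lhi).2) (b := (n : ℤ) + 1) (by positivity)
        have h2 : Real.log x ^ (n + 1) ≤ U ^ (n + 1) := pow_le_pow_left₀ hl0.le hLhi _
        have hA := hser.2
        generalize (seriesHiN n Lhi).2 = A at h1 hA
        have hn1 : (0 : ℝ) < (n : ℝ) + 1 := by positivity
        push_cast at h1 ⊢
        have hx0 : (0 : ℝ) ≤ x := by positivity
        have h3 : Real.log x ^ (n + 1) / ((n + 1 : ℝ) * ((n + 1).factorial : ℝ)) * 2 ^ 80 ≤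
            (A : ℝ) / (n + 1) := by
          rw [le_div_iff₀ hn1]
          calc Real.log x ^ (n + 1) / ((↑n + 1) * ((n + 1).factorial : ℝ)) * 2 ^ 80 * (↑n + 1)
              = Real.log x ^ (n + 1) / ((n + 1).factorial : ℝ) * 2 ^ 80 := by field_simp
            _ ≤ U ^ (n + 1) / ((n + 1).factorial : ℝ) * 2 ^ 80 := by gcongr
            _ ≤ A := hA
        calc (x : ℝ) * (Real.log x ^ (n + 1) / ((↑n + 1) * ((n + 1).factorial : ℝ))) * 2 ^ 80
            = (x : ℝ) * (Real.log x ^ (n + 1) / ((↑n + 1) * ((n + 1).factorial : ℝ)) * 2 ^ 80) := by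
              ring
          _ ≤ (x : ℝ) * ((A : ℝ) / (n + 1)) := mul_le_mul_of_nonneg_left h3 hx0
          _ ≤ (x : ℝ) * _ := mul_le_mul_of_nonneg_left h1 hx0
      have hsum' : (∑ k ∈ range n, logIntegralSeriesTerm (x : ℝ) k) * 2 ^ 80 ≤ ((seriesHiN n Lhi).1 : ℝ) :=
        le_trans (mul_le_mul_of_nonneg_right hsum (by positivity)) hser.1
      generalize (seriesHiN n Lhi).1 = T at hsum' ⊢
      generalize cdiv (seriesHiN n Lhi).2 ((n : ℤ) + 1) = A' at htail ⊢
      generalize ∑ k ∈ range n, logIntegralSeriesTerm (x : ℝ) k = Ssum at hli hsum'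
      generalize (x : ℝ) * (Real.log x ^ (n + 1) / ((n + 1 : ℝ) * ((n + 1).factorial : ℝ))) = tl
        at hli htail
      push_cast
      nlinarith
    · simp at h
  · simp at h

/-- **`liLoN` is a lower bound**: `liLoN n x = some v`, `3 ≤ x` ⟹ `v ≤ 2⁸⁰ li x` (the proof of
`liLo_sound` with `NT ↦ n`). [folklore] -/
theorem liLoN_sound {n x : ℕ} {v : ℤ} (h : liLoN n x = some v) (hx : 3 ≤ x) :
    (v : ℝ) ≤ logIntegral x * 2 ^ 80 := by
  unfold liLoN at h
  split at h
  · rename_i Llo Lhi hlog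
    split at h
    · rename_i ll hll
      simp only [Option.some.injEq] at h
      subst h
      have hx' : (1 : ℝ) < x := by exact_mod_cast (lt_of_lt_of_le (by norm_num) hx)
      obtain ⟨hLlo, hLhi⟩ := logIv_sound hlog
      have hl0 : 0 < Real.log x := Real.log_pos hx'
      set L' : ℝ := (Llo : ℝ) / 2 ^ 80 with hL
      by_cases hLlo60 : 2 ^ 60 ≤ Llo
      · have hLlo0 : (0 : ℝ) ≤ Llo := by exact_mod_cast (le_trans (by norm_num) hLlo60)
        have hL0 : 0 ≤ L' := by rw [hL]; positivity
        have hLloR : (Llo : ℝ) ≤ Real.log x * 2 ^ 80 := by rwa [hL, div_le_iff₀ (by positivity)] at hLlo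
        have hli := (logIntegral_mem_Icc hx' n).1
        have hsum := le_sum_logIntegralSeriesTerm hL0 hLlo n
        have hser := seriesLoN_sound n L' Llo hL0 (le_trans (by norm_num) hLlo60)
          (by rw [hL, SC_eq]; field_simp; rfl)
        rw [SC_eq] at hser
        have hll' := loglogLo_sound hll hLlo60 (y := Real.log x) hLloR
        have hγ := gamma_bounds.2
        have hsum' : ((seriesLoN n Llo : ℤ) : ℝ) ≤ (∑ k ∈ range n, logIntegralSeriesTerm (x : ℝ) k) * 2 ^ 80 :=
          hser.trans (mul_le_mul_of_nonneg_right hsum (by positivity))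
        generalize seriesLoN n Llo = T at hsum' ⊢
        generalize ∑ k ∈ range n, logIntegralSeriesTerm (x : ℝ) k = Ssum at hli hsum'
        push_cast
        nlinarith
      · exfalso
        unfold loglogLo at hll
        have hm : Llo.toNat / 2 ^ 60 = 0 := by
          rw [Nat.div_eq_zero_iff]
          right
          by_contra hc
          rw [not_lt] at hc
          have : (2 : ℤ) ^ 60 ≤ (Llo.toNat : ℤ) := by exact_mod_cast hc
          have h2 : (Llo.toNat : ℤ) ≤ max Llo 0 := by simp
          omega
        rw [hm] at hll
        simp [logIv] at hll
    · simp at h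
  · simp at h

/-! ### One cell -/

/-- **Soundness of one cell check**: (U) and (L) at integers `3 ≤ a < b` give
`|π(x) − li(x)| < 4613.5` for real `x ∈ [a, b)`. [folklore] -/
theorem cell_sound {a b : ℕ} {llA lhB : ℤ} (ha : 3 ≤ a) (hab : a < b)
    (hll : liLoN NTB a = some llA) (hlh : liHiN NTB b = some lhB)
    (hU : 2 * (lhB - (Nat.primeCounting a : ℤ) * SC) < B2 * SC)
    (hL : 2 * ((Nat.primeCounting (b - 1) : ℤ) * SC - llA) < B2 * SC) :
    ∀ x : ℝ, (a : ℝ) ≤ x → x < b →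
      |(Nat.primeCounting ⌊x⌋₊ : ℝ) - logIntegral x| < 4613.5 := by
  intro x hax hxb
  have ha1 : (1 : ℝ) < a := by exact_mod_cast (lt_of_lt_of_le (by norm_num) ha)
  have hx1 : 1 < x := by linarith
  have hx0 : 0 ≤ x := by linarith
  have hb1 : 1 < b := by omega
  -- the floor
  have hfl1 : a ≤ ⌊x⌋₊ := Nat.le_floor hax
  have hfl2 : ⌊x⌋₊ ≤ b - 1 := by have := (Nat.floor_lt hx0).2 hxb; omega
  have hπ1 : (Nat.primeCounting a : ℝ) ≤ Nat.primeCounting ⌊x⌋₊ := by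
    exact_mod_cast Nat.monotone_primeCounting hfl1
  have hπ2 : (Nat.primeCounting ⌊x⌋₊ : ℝ) ≤ Nat.primeCounting (b - 1) := by
    exact_mod_cast Nat.monotone_primeCounting hfl2
  -- li
  have hmono : StrictMonoOn logIntegral (Set.Ioi 1) := strictMonoOn_logIntegral_holds
  have hli1 : logIntegral a ≤ logIntegral x := hmono.monotoneOn ha1 hx1 hax
  have hli2 : logIntegral x ≤ logIntegral b :=
    hmono.monotoneOn hx1 (show (1 : ℝ) < (b : ℝ) by exact_mod_cast hb1) hxb.le
  have hlo := liLoN_sound hll ha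
  have hhi := liHiN_sound hlh hb1
  -- integer checks to reals
  have hUr : 2 * ((lhB : ℝ) - (Nat.primeCounting a : ℝ) * 2 ^ 80) < 9227 * 2 ^ 80 := by
    have : (((2 * (lhB - (Nat.primeCounting a : ℤ) * SC)) : ℤ) : ℝ) < ((B2 * SC : ℤ) : ℝ) := by
      exact_mod_cast hU
    rw [← SC_eq]; unfold B2 at this; push_cast at this ⊢; exact this
  have hLr : 2 * ((Nat.primeCounting (b - 1) : ℝ) * 2 ^ 80 - llA) < 9227 * 2 ^ 80 := by
    have : (((2 * ((Nat.primeCounting (b - 1) : ℤ) * SC - llA)) : ℤ) : ℝ) < ((B2 * SC : ℤ) : ℝ) := by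
      exact_mod_cast hL
    rw [← SC_eq]; unfold B2 at this; push_cast at this ⊢; exact this
  have h280 : (0 : ℝ) ≤ 2 ^ 80 := by positivity
  have e1 : logIntegral x * 2 ^ 80 ≤ lhB := le_trans (mul_le_mul_of_nonneg_right hli2 h280) hhi
  have e2 : (llA : ℝ) ≤ logIntegral x * 2 ^ 80 := hlo.trans (mul_le_mul_of_nonneg_right hli1 h280)
  have e3 := mul_le_mul_of_nonneg_right hπ1 h280
  have e4 := mul_le_mul_of_nonneg_right hπ2 h280
  rw [abs_lt]
  constructor <;> linarith

/-! ### `π` bookkeeping -/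

/-- `π(a) = π(a − 1) + [a prime]` (`1 ≤ a`). [folklore] -/
theorem primeCounting_eq_ite {a : ℕ} (ha : 1 ≤ a) :
    Nat.primeCounting a = Nat.primeCounting (a - 1) + (if a.Prime then 1 else 0) := by
  have h1 := count_prime_eq_primeCounting (n := a + 1) (by omega)
  have h2 := count_prime_eq_primeCounting ha
  rw [Nat.add_sub_cancel] at h1
  rw [← h1, ← h2, Nat.count_succ]

/-! ### The cell with retries -/

/-- **Soundness of `tryCell`**: a returned cell `[N + r, N + r')` carries the bound, and
`pib = π(N + r' − 1)`. [folklore] -/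
theorem tryCell_sound {N : ℕ} (hN : Even N) (hlo : PMAX < N) (hhi : N + 2 * L ≤ PMAX ^ 2)
    {r pia : ℕ} {llA : ℤ} (hr1 : 1 ≤ r) (hr2 : r < 2 * L + 1)
    (hpia : pia = Nat.primeCounting (N + r)) (hll : liLoN NTB (N + r) = some llA) :
    ∀ (fuel h : ℕ) {r' pib : ℕ}, tryCell (surv pats N) N r pia llA fuel h = some (r', pib) →
      r < r' ∧ r' ≤ 2 * L + 1 ∧ pib = Nat.primeCounting (N + r' - 1) ∧
        ∀ x : ℝ, ((N + r : ℕ) : ℝ) ≤ x → x < ((N + r' : ℕ) : ℝ) →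
          |(Nat.primeCounting ⌊x⌋₊ : ℝ) - logIntegral x| < 4613.5
  | 0, h, r', pib, hr => by simp [tryCell] at hr
  | fuel + 1, h, r', pib, hr => by
      rw [tryCell] at hr
      generalize hb : min (2 * L + 1) (r + max 1 h) = b at hr
      have hrb : r < b := by rw [← hb]; exact lt_min hr2 (by omega)
      have hbe : b ≤ 2 * L + 1 := by rw [← hb]; exact min_le_left _ _
      have hpib' : pia + primesInR (surv pats N) (r + 1) b = Nat.primeCounting (N + b - 1) := by
        rw [primesInR_eq hN hlo hhi (by omega) (by omega) hbe, hpia,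
          count_prime_eq_primeCounting (by omega), count_prime_eq_primeCounting (by omega),
          show N + (r + 1) - 1 = N + r by omega]
        have := Nat.monotone_primeCounting (show N + r ≤ N + b - 1 by omega)
        omega
      generalize hq : pia + primesInR (surv pats N) (r + 1) b = pib' at hr hpib'
      split at hr
      · rename_i lhB hlh
        split_ifs at hr with hchk
        · simp only [Option.some.injEq, Prod.mk.injEq] at hr
          obtain ⟨rfl, rfl⟩ := hr
          refine ⟨hrb, hbe, hpib', ?_⟩
          obtain ⟨hU, hL⟩ := hchk
          have ha3 : 3 ≤ N + r := by unfold PMAX at hlo; omega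
          have hcell := cell_sound ha3 (show N + r < N + b by omega) hll hlh (hpia ▸ hU)
            (by rw [hpib'] at hL; exact hL)
          intro x hx1 hx2
          exact hcell x (by exact_mod_cast hx1) (by exact_mod_cast hx2)
        · exact tryCell_sound hN hlo hhi hr1 hr2 hpia hll fuel (h / 2) hr
      · simp at hr

/-! ### The loops -/

/-- **Soundness of the cell loop of one segment**. [folklore] -/
theorem segCells_sound {N : ℕ} (hN : Even N) (hlo : PMAX < N) (hhi : N + 2 * L ≤ PMAX ^ 2) :
    ∀ (fuel r cnt c' : ℕ), segCells (surv pats N) N fuel r cnt = some c' →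
      1 ≤ r → r ≤ 2 * L + 1 → cnt = Nat.primeCounting (N + r - 1) →
      c' = Nat.primeCounting (N + 2 * L) ∧
        ∀ x : ℝ, ((N + r : ℕ) : ℝ) ≤ x → x < ((N + 2 * L + 1 : ℕ) : ℝ) →
          |(Nat.primeCounting ⌊x⌋₊ : ℝ) - logIntegral x| < 4613.5
  | 0, r, cnt, c', h, hr1, hr2, hc => by
      simp only [segCells] at h
      split_ifs at h with her
      simp only [Option.some.injEq] at h
      have hre : r = 2 * L + 1 := le_antisymm hr2 her
      subst hre; subst h
      exact ⟨by rw [hc, show N + (2 * L + 1) - 1 = N + 2 * L by omega],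
          fun x h1 h2 ↦ absurd (lt_of_le_of_lt h1 h2) (lt_irrefl _)⟩
  | fuel + 1, r, cnt, c', h, hr1, hr2, hc => by
      rw [segCells] at h
      by_cases her : 2 * L + 1 ≤ r
      · rw [if_pos her] at h
        simp only [Option.some.injEq] at h
        have hre : r = 2 * L + 1 := le_antisymm hr2 her
        subst hre; subst h
        exact ⟨by rw [hc, show N + (2 * L + 1) - 1 = N + 2 * L by omega],
          fun x h1 h2 ↦ absurd (lt_of_le_of_lt h1 h2) (lt_irrefl _)⟩
      rw [if_neg her] at h
      have hr2' : r < 2 * L + 1 := not_le.1 her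
      -- `π(N + r)`
      have hpia : (if isPrimeR (surv pats N) r = true then cnt + 1 else cnt) =
          Nat.primeCounting (N + r) := by
        rw [primeCounting_eq_ite (show 1 ≤ N + r by omega), ← hc]
        by_cases hp : (N + r).Prime
        · rw [if_pos ((isPrimeR_iff hN hlo hhi hr1 (by omega)).2 hp), if_pos hp]
        · rw [if_neg (fun h' ↦ hp ((isPrimeR_iff hN hlo hhi hr1 (by omega)).1 h')), if_neg hp]
          rfl
      generalize hP : (if isPrimeR (surv pats N) r = true then cnt + 1 else cnt) = pia at h hpia
      split at h
      · rename_i llA hll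
        dsimp only at h
        split at h
        · rename_i r' pib htc
          obtain ⟨hrr', hr'e, hpib, hcell⟩ := tryCell_sound hN hlo hhi hr1 hr2' hpia hll _ _ htc
          have ih := segCells_sound hN hlo hhi fuel r' pib c' h (by omega) hr'e hpib
          refine ⟨ih.1, fun x hx1 hx2 ↦ ?_⟩
          by_cases hxb : x < ((N + r' : ℕ) : ℝ)
          · exact hcell x hx1 hxb
          · exact ih.2 x (not_lt.1 hxb) hx2
        · simp at h
      · simp at h

/-- **Soundness of a block of segments**. [folklore] -/
theorem chunkSegs_sound : ∀ (m N cnt c' : ℕ), chunkSegs pats m N cnt = some c' →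
    Even N → PMAX < N → N + 2 * L * m ≤ PMAX ^ 2 → cnt = Nat.primeCounting N →
    c' = Nat.primeCounting (N + 2 * L * m) ∧
      ∀ x : ℝ, (N : ℝ) + 1 ≤ x → x < (N : ℝ) + 2 * L * m + 1 →
        |(Nat.primeCounting ⌊x⌋₊ : ℝ) - logIntegral x| < 4613.5
  | 0, N, cnt, c', h, _, _, _, hc => by
      simp only [chunkSegs, Option.some.injEq] at h
      subst h
      refine ⟨by simpa using hc, fun x h1 h2 ↦ ?_⟩
      push_cast at h2
      linarith
  | m + 1, N, cnt, c', h, hN, hlo, hhi, hc => by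
      rw [chunkSegs] at h
      have hhi0 : N + 2 * L ≤ PMAX ^ 2 := le_trans (by nlinarith [Nat.zero_le (2 * L * m)]) hhi
      split at h
      · rename_i c'' hseg
        obtain ⟨hc'', hbound⟩ := segCells_sound hN hlo hhi0 _ _ _ _ hseg le_rfl (by omega)
          (by rw [hc, Nat.add_sub_cancel])
        have hN' : Even (N + 2 * L) := hN.add ⟨L, two_mul L⟩
        obtain ⟨ih1, ih2⟩ := chunkSegs_sound m (N + 2 * L) c'' c' h hN' (by omega)
          (by rw [mul_add, mul_one] at hhi; omega) hc''
        refine ⟨by rw [ih1, show N + 2 * L + 2 * L * m = N + 2 * L * (m + 1) by ring],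
          fun x hx1 hx2 ↦ ?_⟩
        by_cases hx : x < ((N + 2 * L + 1 : ℕ) : ℝ)
        · exact hbound x (by exact_mod_cast hx1) hx
        · refine ih2 x ?_ ?_
          · push_cast at hx ⊢; linarith
          · push_cast at hx2 ⊢; linarith
      · simp at h

/-! ### Block interface -/

/-- **The block invariant** at an even boundary `N` with count `c`: `c = π(N)` and the bound of the
fact holds for real `x ∈ [49999999, N + 1)`. [folklore] -/
def BrentOK (N c : ℕ) : Prop :=
  c = Nat.primeCounting N ∧
    ∀ x : ℝ, 49999999 ≤ x → x < (N : ℝ) + 1 →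
      |(Nat.primeCounting ⌊x⌋₊ : ℝ) - logIntegral x| < 4613.5

/-- The start of the chain: at `N = 49999998` the invariant is just the count. [folklore] -/
theorem brentOK_init {c : ℕ} (hc : c = Nat.primeCounting 49999998) : BrentOK 49999998 c :=
  ⟨hc, fun x h1 h2 ↦ by norm_num at h2; linarith⟩

/-- **One block**: a passing `checkChunk N m cIn cOut` carries the invariant from `N` to `N + 2Lm`.
[folklore] -/
theorem brentOK_step {N m cIn cOut : ℕ} (h : checkChunk N m cIn cOut = true) (hN : Even N)
    (hlo : 49999998 ≤ N) (hhi : N + 2 * L * m ≤ PMAX ^ 2) (hB : BrentOK N cIn) :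
    BrentOK (N + 2 * L * m) cOut := by
  unfold checkChunk at h
  have hrun : chunkSegs pats m N cIn = some cOut := by simpa using h
  have hs := chunkSegs_sound m N cIn cOut hrun hN (by unfold PMAX; omega) hhi hB.1
  refine ⟨hs.1, fun x hx1 hx2 ↦ ?_⟩
  by_cases hx : x < (N : ℝ) + 1
  · exact hB.2 x hx1 hx
  · exact hs.2 x (not_lt.1 hx) (by push_cast at hx2 ⊢; linarith)

/-- **Extraction**: the invariant beyond `49·10⁸` gives the statement of the fact on
`[5·10⁷, 49·10⁸]`. [cite: Schoenfeld1976, proof of Cor. 1 (p. 340)] -/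
theorem bound_of_brentOK {N c : ℕ} (h : BrentOK N c) (hN : 4900000000 ≤ N) :
    ∀ x : ℝ, 5 * 10 ^ 7 ≤ x → x ≤ 49 * 10 ^ 8 →
      |(Nat.primeCounting ⌊x⌋₊ : ℝ) - logIntegral x| < 4613.5 := by
  intro x h1 h2
  have hN' : (4900000000 : ℝ) ≤ N := by exact_mod_cast hN
  exact h.2 x (by linarith) (by linarith)

end Soundness

end BrentSieve

end Literature.NumberTheory.LFunctions
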